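import Mathlib
import Summits.Ventures.PercRepro.TriangleCapTopTwentyFive

/-!
# PercRepro — THE LAYER WITNESS: DEFINITIONS AND STRUCTURE (p3, gen 51; part 230)

A uniform witness family for every band of the cherry table.  On `Fin n` with parts `{i < a}` / `{a ≤ i}`,
`layerWitness n a r t u m` is `K_{a, n−a}` minus the `(r − t)`-star at `0` (`bipMinusStar n a (r − t)`) minus `t`
further cross pairs (`layerPairs`): the `i`-th off-pair joins the left end `lEnd a u i` (the star centre `a − 1` for
`i < u`, the matching vertex `1 + (i − u)` for `u ≤ i`) to the right end `rEnd n a m i` (the leaf `a + i` of the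
star for `i < m`, the non-leaf `n − 1 − (i − m)` for `m ≤ i`).  So the missing graph is the `(r − t)`-star at `0`
plus a `u`-star at `a − 1` plus a matching of `t − u` pairs, `m` of the `t` off-pairs ending at a leaf of the star.

This module sets up the family and its structure: the witness is `K₄⁻`-free and a spanning subgraph of
`K(A, Aᶜ)` (`A = {i < a}`); its missing graph `H` has `deg H 0 = r − t` with neighbourhood `rightStar n a (r − t)`
and `offEdges H 0 = layerPairs` of cardinality `t` (hypotheses `1 ≤ t`, `u ≤ t`, `m ≤ t`, `t + 1 ≤ a`, `t + m ≤ r`,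
`a + r ≤ n`).  The counts (`attach = m`, `offAdjPairs = u (u − 1)`) and the value are in the next module.
Axioms: standard.
-/

namespace PercRepro

namespace TriangleCap

namespace C047

open Finset

variable {V : Type*} [Fintype V] [DecidableEq V]

/-! ### Deleting a finite set of pairs -/

/-- `D` minus the pairs in `S` (pairs of `S` that are not edges are ignored). -/
def delEdges (D : SimpleGraph V) (S : Finset (Sym2 V)) : SimpleGraph V where
  Adj u w := D.Adj u w ∧ s(u, w) ∉ S
  symm := ⟨fun u w h => ⟨D.adj_symm h.1, by rw [Sym2.eq_swap]; exact h.2⟩⟩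
  loopless := ⟨fun u h => D.irrefl h.1⟩

/-- Adjacency in `D` minus a set of pairs is decidable. -/
instance decidableRelDelEdges (D : SimpleGraph V) [DecidableRel D.Adj] (S : Finset (Sym2 V)) :
    DecidableRel (delEdges D S).Adj :=
  fun u w => inferInstanceAs (Decidable (D.Adj u w ∧ s(u, w) ∉ S))

omit [Fintype V] [DecidableEq V] in
/-- Adjacency in `D` minus a set of pairs. -/
theorem delEdges_adj (D : SimpleGraph V) (S : Finset (Sym2 V)) (u w : V) :
    (delEdges D S).Adj u w ↔ D.Adj u w ∧ s(u, w) ∉ S := Iff.rfl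

omit [Fintype V] [DecidableEq V] in
/-- `D` minus a set of pairs is a subgraph of `D`. -/
theorem delEdges_le (D : SimpleGraph V) (S : Finset (Sym2 V)) : delEdges D S ≤ D := fun _ _ h => h.1

/-! ### The off-pairs of the layer witness -/

/-- `v mod n` as an element of `Fin n`. -/
def fin' (n : ℕ) (hn : 0 < n) (v : ℕ) : Fin n := ⟨v % n, Nat.mod_lt v hn⟩

/-- `fin' n hn v` has value `v` for `v < n`. -/
theorem fin'_val (n : ℕ) (hn : 0 < n) (v : ℕ) (hv : v < n) : (fin' n hn v).val = v := Nat.mod_eq_of_lt hv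

/-- The left end of the `i`-th off-pair: the star centre `a − 1` for `i < u`, the matching vertex `1 + (i − u)`
for `u ≤ i`. -/
def lEnd (a u i : ℕ) : ℕ := if i < u then a - 1 else 1 + (i - u)

/-- The right end of the `i`-th off-pair: the leaf `a + i` for `i < m`, the non-leaf `n − 1 − (i − m)` for
`m ≤ i`. -/
def rEnd (n a m i : ℕ) : ℕ := if i < m then a + i else n - 1 - (i - m)

/-- The `i`-th off-pair. -/
def layerPair (n a u m : ℕ) (hn : 0 < n) (i : ℕ) : Sym2 (Fin n) :=
  s(fin' n hn (lEnd a u i), fin' n hn (rEnd n a m i))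

/-- The `t` off-pairs. -/
def layerPairs (n a t u m : ℕ) (hn : 0 < n) : Finset (Sym2 (Fin n)) := (range t).image (layerPair n a u m hn)

/-- **THE LAYER WITNESS:** `K_{a, n−a}` minus the `(r − t)`-star at `0` minus the `t` off-pairs. -/
def layerWitness (n a r t u m : ℕ) (hn : 0 < n) : SimpleGraph (Fin n) :=
  delEdges (bipMinusStar n a (r - t)) (layerPairs n a t u m hn)

/-- Adjacency in the layer witness is decidable. -/
instance decidableRelLayerWitness (n a r t u m : ℕ) (hn : 0 < n) : DecidableRel (layerWitness n a r t u m hn).Adj :=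
  inferInstanceAs (DecidableRel (delEdges (bipMinusStar n a (r - t)) (layerPairs n a t u m hn)).Adj)

/-- The left part `{i < a}`. -/
def leftPart (n a : ℕ) : Finset (Fin n) := univ.filter (fun i : Fin n => i.val < a)

/-! ### The ends -/

/-- `1 ≤ lEnd a u i` for `2 ≤ a`. -/
theorem one_le_lEnd (a u i : ℕ) (ha : 2 ≤ a) : 1 ≤ lEnd a u i := by
  unfold lEnd
  split_ifs <;> omega

/-- `lEnd a u i < a` for `i < t`, `u ≤ t`, `t + 1 ≤ a`. -/
theorem lEnd_lt (a t u i : ℕ) (hi : i < t) (ha : t + 1 ≤ a) : lEnd a u i < a := by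
  unfold lEnd
  split_ifs <;> omega

/-- `a ≤ rEnd n a m i` for `i < t`, `t + m ≤ r`, `a + r ≤ n`. -/
theorem le_rEnd (n a r t m i : ℕ) (hi : i < t) (hr : t + m ≤ r) (han : a + r ≤ n) : a ≤ rEnd n a m i := by
  unfold rEnd
  split_ifs <;> omega

/-- `rEnd n a m i < n` for `i < t`, `t + m ≤ r`, `a + r ≤ n`. -/
theorem rEnd_lt (n a r t m i : ℕ) (hi : i < t) (hr : t + m ≤ r) (han : a + r ≤ n) : rEnd n a m i < n := by
  unfold rEnd
  split_ifs <;> omega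

/-- `lEnd a u i < n` for `i < t`, `u ≤ t`, `t + 1 ≤ a ≤ n`. -/
theorem lEnd_lt_n (n a t u i : ℕ) (hi : i < t) (ha : t + 1 ≤ a) (han : a ≤ n) : lEnd a u i < n :=
  lt_of_lt_of_le (lEnd_lt a t u i hi ha) han

/-- The right end is a leaf of the star (`< a + (r − t)`) iff `i < m` (for `i < t`, `t + m ≤ r`, `a + r ≤ n`). -/
theorem rEnd_lt_iff (n a r t m i : ℕ) (hi : i < t) (hr : t + m ≤ r) (han : a + r ≤ n) :
    rEnd n a m i < a + (r - t) ↔ i < m := by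
  unfold rEnd
  split_ifs with h <;> omega

/-- The right ends are distinct. -/
theorem rEnd_inj (n a r t m i i' : ℕ) (hi : i < t) (hi' : i' < t) (hr : t + m ≤ r) (han : a + r ≤ n)
    (h : rEnd n a m i = rEnd n a m i') : i = i' := by
  unfold rEnd at h
  split_ifs at h <;> omega

/-- Two left ends agree iff the indices agree or both pairs belong to the star at `a − 1`. -/
theorem lEnd_eq_iff (a t u i i' : ℕ) (hi : i < t) (hi' : i' < t) (ha : t + 1 ≤ a) :
    lEnd a u i = lEnd a u i' ↔ i = i' ∨ (i < u ∧ i' < u) := by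
  unfold lEnd
  split_ifs <;> omega

/-- Membership in the `i`-th off-pair (`i < t`): the value is the left or the right end. -/
theorem mem_layerPair_iff (n a r t u m : ℕ) (hn : 0 < n) (i : ℕ) (hi : i < t) (ha : t + 1 ≤ a)
    (hr : t + m ≤ r) (han : a + r ≤ n) (v : Fin n) :
    v ∈ layerPair n a u m hn i ↔ v.val = lEnd a u i ∨ v.val = rEnd n a m i := by
  unfold layerPair
  rw [Sym2.mem_iff, Fin.ext_iff, Fin.ext_iff, fin'_val n hn _ (lEnd_lt_n n a t u i hi ha (by omega)),
    fin'_val n hn _ (rEnd_lt n a r t m i hi hr han)]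

/-- The vertex `0` lies in no off-pair. -/
theorem zero_notMem_layerPair (n a r t u m : ℕ) (hn : 0 < n) (i : ℕ) (hi : i < t) (ha : t + 1 ≤ a)
    (hr : t + m ≤ r) (han : a + r ≤ n) : fin' n hn 0 ∉ layerPair n a u m hn i := by
  rw [mem_layerPair_iff n a r t u m hn i hi ha hr han, fin'_val n hn 0 hn]
  have h1 := one_le_lEnd a u i (by omega)
  have h2 := le_rEnd n a r t m i hi hr han
  omega

/-- Two off-pairs (`i, i' < t`) agree iff their indices agree. -/
theorem layerPair_eq_iff (n a r t u m : ℕ) (hn : 0 < n) (i i' : ℕ) (hi : i < t) (hi' : i' < t)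
    (ha : t + 1 ≤ a) (hr : t + m ≤ r) (han : a + r ≤ n) :
    layerPair n a u m hn i = layerPair n a u m hn i' ↔ i = i' := by
  constructor
  · intro h
    unfold layerPair at h
    rw [Sym2.eq_iff, Fin.ext_iff, Fin.ext_iff, Fin.ext_iff, Fin.ext_iff,
      fin'_val n hn _ (lEnd_lt_n n a t u i hi ha (by omega)), fin'_val n hn _ (rEnd_lt n a r t m i hi hr han),
      fin'_val n hn _ (lEnd_lt_n n a t u i' hi' ha (by omega)),
      fin'_val n hn _ (rEnd_lt n a r t m i' hi' hr han)] at h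
    rcases h with ⟨-, h2⟩ | ⟨h1, -⟩
    · exact rEnd_inj n a r t m i i' hi hi' hr han h2
    · have := lEnd_lt a t u i hi ha
      have := le_rEnd n a r t m i' hi' hr han
      omega
  · rintro rfl
    rfl

/-- Membership in the off-pairs. -/
theorem mem_layerPairs (n a t u m : ℕ) (hn : 0 < n) (e : Sym2 (Fin n)) :
    e ∈ layerPairs n a t u m hn ↔ ∃ i, i < t ∧ layerPair n a u m hn i = e := by
  unfold layerPairs
  simp only [mem_image, mem_range]

/-- **`|layerPairs| = t`.** -/
theorem card_layerPairs (n a r t u m : ℕ) (hn : 0 < n) (ha : t + 1 ≤ a) (hr : t + m ≤ r)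
    (han : a + r ≤ n) : (layerPairs n a t u m hn).card = t := by
  unfold layerPairs
  rw [card_image_of_injOn, card_range]
  intro i hi i' hi' h
  simp only [coe_range, Set.mem_Iio] at hi hi'
  exact (layerPair_eq_iff n a r t u m hn i i' hi hi' ha hr han).mp h

/-- An off-pair is a cross pair not at `0`: its two ends `x, y` satisfy `1 ≤ x < a ≤ y` (up to order). -/
theorem layerPair_cross (n a r t u m : ℕ) (hn : 0 < n) (ha : t + 1 ≤ a) (hr : t + m ≤ r)
    (han : a + r ≤ n) (x y : Fin n) (h : s(x, y) ∈ layerPairs n a t u m hn) :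
    (1 ≤ x.val ∧ x.val < a ∧ a ≤ y.val) ∨ (1 ≤ y.val ∧ y.val < a ∧ a ≤ x.val) := by
  rw [mem_layerPairs] at h
  obtain ⟨i, hi, he⟩ := h
  unfold layerPair at he
  rw [Sym2.eq_iff, Fin.ext_iff, Fin.ext_iff, Fin.ext_iff, Fin.ext_iff,
    fin'_val n hn _ (lEnd_lt_n n a t u i hi ha (by omega)), fin'_val n hn _ (rEnd_lt n a r t m i hi hr han)] at he
  have h1 := one_le_lEnd a u i (by omega)
  have h2 := lEnd_lt a t u i hi ha
  have h3 := le_rEnd n a r t m i hi hr han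
  rcases he with ⟨hx, hy⟩ | ⟨hx, hy⟩
  · left; omega
  · right; omega

/-! ### The witness -/

/-- The layer witness is `K₄⁻`-free. -/
theorem k4mFree_layerWitness (n a r t u m : ℕ) (hn : 0 < n) : K4mFree (layerWitness n a r t u m hn) :=
  k4mFree_of_le _ _ (delEdges_le _ _) (k4mFree_bipMinusStar n a (r - t))

/-- The layer witness is a spanning subgraph of `K(A, Aᶜ)`, `A = {i < a}`. -/
theorem bipSub_layerWitness (n a r t u m : ℕ) (hn : 0 < n) :
    BipSub (layerWitness n a r t u m hn) (leftPart n a) :=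
  fun x y h => bipMinusStar_bipartite n a (r - t) x y h.1

/-- `|leftPart n a| = a` for `a ≤ n`. -/
theorem card_leftPart (n a : ℕ) (h : a ≤ n) : (leftPart n a).card = a := card_left n a h

/-- Adjacency in the missing graph of the layer witness on a cross pair `x < a ≤ y`: the pair is missing iff it
is a star edge at `0` or an off-pair. -/
theorem missingGraph_layerWitness_adj (n a r t u m : ℕ) (hn : 0 < n) (x y : Fin n) (hx : x.val < a)
    (hy : a ≤ y.val) :
    (missingGraph (layerWitness n a r t u m hn) (leftPart n a)).Adj x y ↔
      (x.val = 0 ∧ y.val < a + (r - t)) ∨ s(x, y) ∈ layerPairs n a t u m hn := by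
  rw [missingGraph_adj]
  unfold layerWitness
  rw [delEdges_adj, bipMinusStar_adj]
  simp only [leftPart, mem_filter, mem_univ, true_and]
  constructor
  · rintro ⟨-, h⟩
    by_cases hS : s(x, y) ∈ layerPairs n a t u m hn
    · exact Or.inr hS
    · left
      by_contra hc
      apply h
      refine ⟨⟨Or.inl ⟨hx, by omega⟩, ?_⟩, hS⟩
      rintro (⟨h1, h2, h3⟩ | ⟨h1, -, -⟩)
      · exact hc ⟨h1, h3⟩
      · omega
  · intro h
    refine ⟨⟨fun _ => by omega, fun _ => hx⟩, ?_⟩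
    rintro ⟨⟨-, h2⟩, hS⟩
    rcases h with ⟨h1, h3⟩ | h
    · exact h2 (Or.inl ⟨h1, hy, h3⟩)
    · exact hS h

/-- **THE NEIGHBOURHOOD OF `0` IN THE MISSING GRAPH** is the star `rightStar n a (r − t)`. -/
theorem filter_adj_missingGraph_layerWitness (n a r t u m : ℕ) (hn : 0 < n) (ha : t + 1 ≤ a)
    (hr : t + m ≤ r) (han : a + r ≤ n) :
    univ.filter (fun v => (missingGraph (layerWitness n a r t u m hn) (leftPart n a)).Adj (fin' n hn 0) v) =
      rightStar n a (r - t) := by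
  ext v
  simp only [mem_filter, mem_univ, true_and, rightStar]
  by_cases hv : v.val < a
  · rw [missingGraph_adj]
    simp only [leftPart, mem_filter, mem_univ, true_and, fin'_val n hn 0 hn]
    constructor
    · rintro ⟨h, -⟩
      exact absurd hv ((h.mp (by omega)))
    · intro h; omega
  · rw [missingGraph_layerWitness_adj n a r t u m hn _ v (by rw [fin'_val n hn 0 hn]; omega) (by omega),
      fin'_val n hn 0 hn]
    constructor
    · rintro (⟨-, h⟩ | h)
      · exact ⟨by omega, h⟩
      · exfalso
        rw [mem_layerPairs] at h
        obtain ⟨i, hi, he⟩ := h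
        have := zero_notMem_layerPair n a r t u m hn i hi ha hr han
        rw [he] at this
        exact this (Sym2.mem_mk_left _ _)
    · rintro ⟨-, h⟩
      exact Or.inl ⟨rfl, h⟩

/-- **`deg H 0 = r − t`** in the missing graph `H` of the layer witness. -/
theorem deg_missingGraph_layerWitness_zero (n a r t u m : ℕ) (hn : 0 < n) (ha : t + 1 ≤ a)
    (hr : t + m ≤ r) (han : a + r ≤ n) :
    deg (missingGraph (layerWitness n a r t u m hn) (leftPart n a)) (fin' n hn 0) = r - t := by
  unfold deg
  rw [filter_adj_missingGraph_layerWitness n a r t u m hn ha hr han, card_rightStar n a (r - t) (by omega)]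

/-- **THE OFF-EDGES OF `0` IN THE MISSING GRAPH** are exactly the off-pairs. -/
theorem offEdges_missingGraph_layerWitness (n a r t u m : ℕ) (hn : 0 < n) (ha : t + 1 ≤ a)
    (hr : t + m ≤ r) (han : a + r ≤ n) :
    offEdges (missingGraph (layerWitness n a r t u m hn) (leftPart n a)) (fin' n hn 0) = layerPairs n a t u m hn := by
  ext e
  rw [mem_offEdges, SimpleGraph.mem_edgeFinset]
  refine Sym2.ind (fun x y => ?_) e
  rw [SimpleGraph.mem_edgeSet, Sym2.mem_iff]
  constructor
  · rintro ⟨hadj, h0⟩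
    have hcross := (missingGraph_adj _ _ x y).mp hadj
    simp only [leftPart, mem_filter, mem_univ, true_and] at hcross
    have h0x : x.val ≠ 0 := fun h => h0 (Or.inl (Fin.ext (by rw [fin'_val n hn 0 hn]; exact h.symm)))
    have h0y : y.val ≠ 0 := fun h => h0 (Or.inr (Fin.ext (by rw [fin'_val n hn 0 hn]; exact h.symm)))
    by_cases hx : x.val < a
    · have hy : a ≤ y.val := by
        have := hcross.1.mp hx
        omega
      rcases (missingGraph_layerWitness_adj n a r t u m hn x y hx hy).mp hadj with ⟨h1, -⟩ | h
      · exact absurd h1 h0x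
      · exact h
    · have hy : y.val < a := by
        by_contra hy
        exact hx (hcross.1.mpr hy)
      rcases (missingGraph_layerWitness_adj n a r t u m hn y x hy (by omega)).mp
        ((missingGraph _ _).adj_symm hadj) with ⟨h1, -⟩ | h
      · exact absurd h1 h0y
      · rw [Sym2.eq_swap]
        exact h
  · intro h
    have hc := layerPair_cross n a r t u m hn ha hr han x y h
    refine ⟨?_, ?_⟩
    · rcases hc with ⟨h1, h2, h3⟩ | ⟨h1, h2, h3⟩
      · exact (missingGraph_layerWitness_adj n a r t u m hn x y h2 h3).mpr (Or.inr h)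
      · exact (missingGraph _ _).adj_symm
          ((missingGraph_layerWitness_adj n a r t u m hn y x h2 h3).mpr (Or.inr (by rw [Sym2.eq_swap]; exact h)))
    · rintro (hx | hy)
      · rw [Fin.ext_iff, fin'_val n hn 0 hn] at hx
        omega
      · rw [Fin.ext_iff, fin'_val n hn 0 hn] at hy
        omega

/-- **THE MISSING GRAPH HAS `r` EDGES.** -/
theorem card_edges_missingGraph_layerWitness (n a r t u m : ℕ) (hn : 0 < n) (ha : t + 1 ≤ a)
    (hr : t + m ≤ r) (han : a + r ≤ n) :
    (missingGraph (layerWitness n a r t u m hn) (leftPart n a)).edgeFinset.card = r := by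
  have h := card_offEdges_add_deg (missingGraph (layerWitness n a r t u m hn) (leftPart n a)) (fin' n hn 0)
  rw [offEdges_missingGraph_layerWitness n a r t u m hn ha hr han, card_layerPairs n a r t u m hn ha hr han,
    deg_missingGraph_layerWitness_zero n a r t u m hn ha hr han] at h
  omega

/-- **THE EDGE COUNT OF THE LAYER WITNESS:** `|E| + r = a (n − a)`. -/
theorem card_edges_layerWitness (n a r t u m : ℕ) (hn : 0 < n) (ha : t + 1 ≤ a) (hr : t + m ≤ r)
    (han : a + r ≤ n) : (layerWitness n a r t u m hn).edgeFinset.card + r = a * (n - a) := by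
  have h1 := sum_deg_eq (layerWitness n a r t u m hn)
  have h2 := sum_deg_eq (missingGraph (layerWitness n a r t u m hn) (leftPart n a))
  rw [card_edges_missingGraph_layerWitness n a r t u m hn ha hr han] at h2
  have h3 : ∑ v, (deg (layerWitness n a r t u m hn) v +
      deg (missingGraph (layerWitness n a r t u m hn) (leftPart n a)) v) =
      ∑ v, (if v ∈ leftPart n a then Fintype.card (Fin n) - (leftPart n a).card else (leftPart n a).card) :=
    sum_congr rfl (fun v _ => deg_add_deg_missingGraph _ _ (bipSub_layerWitness n a r t u m hn) v)
  rw [sum_add_distrib, sum_ite_mem_card, card_leftPart n a (by omega), Fintype.card_fin,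
    Nat.mul_comm (n - a) a] at h3
  omega

end C047

end TriangleCap

end PercRepro
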